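import Summits.CriticalPhenomena.CardyFormulaZ2.Theorems.CardyIKTransportIKMixedBoxCrossingDefectStubBridgeLaw
import Summits.CriticalPhenomena.CardyFormulaZ2.Theorems.CardyIKTransportIKMixedBoxCrossingDefectStubBridgeOfLaw

/-!
# Stub `stub_bridge : GaugeBridge` (line `defect-closure-exploration`, crux `IKMixedBoxCrossing`, stmt-CriticalPhenomena-5911)

Support file (`--supports stmt-CriticalPhenomena-5911`). The GAUGE BRIDGE — the crux's infinite-volume gauge crossing
probabilities `Negative.pH / pV` ARE the finite free corner-Gibbs model probabilities `hfree / vfree` — assembled from its two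
landed halves: the law identity at the origin (`stub_bridgeLaw`, …DefectStubBridgeLaw.lean, p118175) and its transport to every
position and to the crossing events (`stub_bridgeOfLaw`, …DefectStubBridgeOfLaw.lean, p119385), through the registered glue
`gaugeBridge_of_stubs` of `…DefectGlueDefs.lean` §6 (lead c2, reshape v3).
-/

namespace Summit.CriticalPhenomena.CardyFormulaZ2.Cruxes.IKMixedBoxCrossing.DefectClosureExploration

/-- **STUB 7 · `stub_bridge`** (= `GaugeBridge`, registered on stmt-CriticalPhenomena-5911): for every column pattern `S`,
every `n` and every position, `Negative.pH S n a b = hfree S a b (2n) n` and `Negative.pV S n a b = vfree S a b n (2n)`. -/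
theorem stub_bridge : GaugeBridge := gaugeBridge_of_stubs stub_bridgeLaw stub_bridgeOfLaw

end Summit.CriticalPhenomena.CardyFormulaZ2.Cruxes.IKMixedBoxCrossing.DefectClosureExploration
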